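import Literature.Combinatorics.Sahi2008.Symmetry
import Literature.Combinatorics.Sahi2008.Indicators
import Summits.CriticalPhenomena.PercolationContinuityZ3.Theorems.PercNearOneGluingNoHeavyLowerTailSahiAbsorbedMemberRForm

/-!
# Sahi's `E_{n+1}` is nonnegative AT EVERY ORDER whenever one member is ABSORBED by all the others — for EVERY probability weight and ARBITRARY
# (non-monotone) members — II: the formula `E_{n+1}(g, f) = E[g]·R(f)`, positivity, and the events corollary

Support file of the one-cut programme (crux `NoHeavyLowerTail`, stmt-CriticalPhenomena-4575; cell `prim-masterthm`, seat P3, gen 18;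
`run/shared/lean/prim/prim-masterthm/prim-masterthm-p3/HIERARCHY.md` §26(e)).  Sequel of `…SahiAbsorbedMemberRForm` (`ncs`, `rform`, `rform_eq_sum_block`, `rform_nonneg`).

* `sahiE_cons_eq_ex_mul_rform` — if `g · f_j = g` for every `j` then `E_{n+1}(g, f_1, …, f_n) = E[g] · R(f)`, `R(f) = Σ_{T ⊆ [n]} |T|!·ncs(f|_{[n]∖T})`
  (block expansion of `E_{n+1}` through the slot of `g` = [LiebSahi2021, Prop. 3.4], tree `sahiE_eq_sum_blocks`; every block through `g` has moment `E[g]`);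
* **`sahiE_cons_nonneg_of_absorbed`** — hence `E_{n+1}(g, f_1, …, f_n) ≥ 0` whenever `E[g] ≥ 0` and every nonempty joint moment of the `f_j` is `≤ 1` (e.g. a probability
  weight and `0 ≤ f_j ≤ 1`): NO monotonicity, NO lattice, NO FKG hypothesis;
* **`sahiE_setInd_cons_nonneg_of_subset`, `sahiE_setInd_nonneg_of_subset_all`** — for every probability weight on a finite type and ARBITRARY events `U_0, …, U_n` one of
  which is contained in all the others, `E_{n+1}(1_{U_0}, …, 1_{U_n}) ≥ 0` (any slot, by the symmetry `sahiE_comp_perm`).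
Known special cases in the tree: `n + 1 = 2` (`Cov(1_U,1_W) = μ(W)(1−μ(U))`), `n + 1 = 3` (`sahiE3_nonneg_of_subset`), the 4-cube instance `sahiE4_nonneg_of_inter_subset_four`;
the all-orders statement is the value-level shadow of the order-`n` C-slot SIGN structure of the slot functional observed this gen (HIERARCHY §26(e)).
Everything proved; axioms standard. [this work]
-/

noncomputable section

namespace Summit.CriticalPhenomena.PercolationContinuityZ3.Theorems

open Finset Function Equiv Equiv.Perm
open Literature.Combinatorics.Sahi2008 Literature.Combinatorics.Sahi2008.CycleForm

namespace SahiAbsorbed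

variable {α : Type*} [Fintype α] (μ : α → ℝ)

/-! ### The absorbed family `(g, f_1, …, f_n)` -/

section Absorbed

variable {n : ℕ} (g : α → ℝ) (f : Fin n → α → ℝ)

omit [Fintype α] in
/-- Absorption propagates to products: `g · Π_{j∈S} f_j = g`. [this work] -/
theorem mul_prod_eq_of_absorbed (hg : ∀ j x, g x * f j x = g x) (S : Finset (Fin n)) (x : α) : g x * ∏ j ∈ S, f j x = g x := by
  induction S using Finset.induction_on with
  | empty => simp
  | insert j S hj ih => rw [prod_insert hj, ← mul_assoc, hg j x, ih]

/-- The blocks through `0` of `Fin (n+1)` are the images `insert 0 (S.map succ)` of the subsets `S` of `Fin n`; the complementary index types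
correspond along `Fin.succ` (plumbing). [this work] -/
def succSdiffEquiv (S : Finset (Fin n)) :
    {y : Fin n // y ∈ (univ : Finset (Fin n)) \ S} ≃ {x : Fin (n + 1) // x ∉ insert (0 : Fin (n + 1)) (S.map (Fin.succEmb n))} where
  toFun y := ⟨y.1.succ, by
    rw [mem_insert, not_or, mem_map]
    refine ⟨Fin.succ_ne_zero _, ?_⟩
    rintro ⟨z, hz, hzy⟩
    have : z = y.1 := Fin.succ_injective _ hzy
    rw [this] at hz
    exact (mem_sdiff.1 y.2).2 hz⟩
  invFun x := ⟨x.1.pred (fun h => x.2 (by rw [h]; exact mem_insert_self _ _)), by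
    rw [mem_sdiff]
    refine ⟨mem_univ _, fun h => x.2 (mem_insert_of_mem (mem_map.2 ⟨_, h, ?_⟩))⟩
    simp⟩
  left_inv y := by
    apply Subtype.ext
    simp
  right_inv x := by
    apply Subtype.ext
    simp

/-- **The absorbed-member formula**: if `g · f_j = g` for every `j`, then `E_{n+1}(g, f_1, …, f_n) = E[g] · R(f)` with
`R(f) = Σ_{T ⊆ [n]} |T|! · ncs(f|_{[n]∖T})`. [this work] -/
theorem sahiE_cons_eq_ex_mul_rform (hg : ∀ j x, g x * f j x = g x) :
    sahiE μ (n + 1) (Fin.cons g f) = ex μ g * rform μ f univ := by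
  rw [sahiE_eq_sum_blocks μ (by omega) (Fin.cons g f) 0]
  -- every block through `0` has moment `E[g]`
  have hmom : ∀ B ∈ univ.filter (fun B : Finset (Fin (n + 1)) => (0 : Fin (n + 1)) ∈ B),
      ex μ (fun x => ∏ j ∈ B, (Fin.cons g f : Fin (n + 1) → α → ℝ) j x) = ex μ g := by
    intro B hB
    rw [mem_filter] at hB
    unfold ex
    refine sum_congr rfl fun x _ => ?_
    dsimp only
    rw [← mul_prod_erase B _ hB.2, Fin.cons_zero]
    -- the remaining indices are successors
    have : ∏ j ∈ B.erase 0, (Fin.cons g f : Fin (n + 1) → α → ℝ) j x = ∏ j ∈ (B.erase 0).preimage Fin.succ (Fin.succ_injective _).injOn, f j x := by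
      rw [← prod_preimage Fin.succ (B.erase 0) (Fin.succ_injective _).injOn (fun j => (Fin.cons g f : Fin (n + 1) → α → ℝ) j x)]
      · exact prod_congr rfl fun j _ => by rw [Fin.cons_succ]
      · intro j hj hj'
        exfalso
        rcases Fin.eq_zero_or_eq_succ j with rfl | ⟨k, rfl⟩
        · exact (notMem_erase 0 B) hj
        · exact hj' ⟨k, rfl⟩
    rw [this, mul_prod_eq_of_absorbed g f hg]
  rw [sum_congr rfl fun B hB => by rw [hmom B hB]]
  -- factor `E[g]` and re-index the blocks `B ∋ 0` by `S = B.preimage succ`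
  unfold rform
  rw [mul_sum]
  symm
  refine sum_bij (fun (S : Finset (Fin n)) _ => insert (0 : Fin (n + 1)) (S.map (Fin.succEmb n))) ?_ ?_ ?_ ?_
  · intro S _
    rw [mem_filter]
    exact ⟨mem_univ _, mem_insert_self _ _⟩
  · intro S₁ _ S₂ _ h
    have h0 : (0 : Fin (n + 1)) ∉ S₁.map (Fin.succEmb n) := by simp
    have h0' : (0 : Fin (n + 1)) ∉ S₂.map (Fin.succEmb n) := by simp
    have := congrArg (fun B => B.erase 0) h
    simp only [erase_insert h0, erase_insert h0'] at this
    exact (map_injective (Fin.succEmb n)) this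
  · intro B hB
    rw [mem_filter] at hB
    refine ⟨(B.erase 0).preimage Fin.succ (Fin.succ_injective _).injOn, mem_powerset.2 (subset_univ _), ?_⟩
    have hmp : ((B.erase 0).preimage Fin.succ (Fin.succ_injective _).injOn).map (Fin.succEmb n) = B.erase 0 := by
      ext x
      rw [mem_map]
      constructor
      · rintro ⟨y, hy, rfl⟩
        rw [mem_preimage] at hy
        exact hy
      · intro hx
        have hx0 : x ≠ 0 := ne_of_mem_erase hx
        rcases Fin.eq_zero_or_eq_succ x with rfl | ⟨k, rfl⟩
        · exact absurd rfl hx0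
        · exact ⟨k, by rw [mem_preimage]; exact hx, rfl⟩
    rw [hmp, insert_erase hB.2]
  · intro S hS
    have hcard : (insert (0 : Fin (n + 1)) (S.map (Fin.succEmb n))).card = S.card + 1 := by
      rw [card_insert_of_notMem (by simp), card_map]
    rw [hcard, Nat.add_sub_cancel]
    -- the complementary factor
    have hco : coRest μ (Fin.cons g f : Fin (n + 1) → α → ℝ) (insert (0 : Fin (n + 1)) (S.map (Fin.succEmb n))) =
        ncs μ f (univ \ S) := by
      unfold coRest ncs
      rw [← signedSum_comp_equiv μ (succSdiffEquiv S)
        (fun x : {x : Fin (n + 1) // x ∉ insert (0 : Fin (n + 1)) (S.map (Fin.succEmb n))} => (Fin.cons g f : Fin (n + 1) → α → ℝ) x)]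
      refine Fintype.sum_congr _ _ fun τ => ?_
      have hF : (fun j : {y : Fin n // y ∈ (univ : Finset (Fin n)) \ S} =>
          (Fin.cons g f : Fin (n + 1) → α → ℝ) ((succSdiffEquiv S j : {x : Fin (n + 1) // x ∉ insert (0 : Fin (n + 1)) (S.map (Fin.succEmb n))}) : Fin (n + 1))) =
          fun j : {y : Fin n // y ∈ (univ : Finset (Fin n)) \ S} => f (j : Fin n) := by
        funext j
        exact Fin.cons_succ (α := fun _ => α → ℝ) g f j.1
      rw [hF]
    rw [hco]
    ring

/-- **SAHI'S `E_{n+1}` IS NONNEGATIVE FOR AN ABSORBED FAMILY, EVERY ORDER, EVERY WEIGHT**: if `g · f_j = g` for all `j`, `E[g] ≥ 0`, and every nonempty joint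
moment of the `f_j` is `≤ 1` (e.g. `μ` a probability weight and `0 ≤ f_j ≤ 1`), then `E_{n+1}(g, f_1, …, f_n) ≥ 0`.  No monotonicity, no lattice, no FKG hypothesis.
[this work] -/
theorem sahiE_cons_nonneg_of_absorbed (hg : ∀ j x, g x * f j x = g x) (hg0 : 0 ≤ ex μ g)
    (hm : ∀ B : Finset (Fin n), B.Nonempty → ex μ (fun x => ∏ j ∈ B, f j x) ≤ 1) : 0 ≤ sahiE μ (n + 1) (Fin.cons g f) := by
  rw [sahiE_cons_eq_ex_mul_rform μ g f hg]
  exact mul_nonneg hg0 (rform_nonneg μ f hm univ)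

end Absorbed

/-! ### Events: a member contained in all the others -/

section Events

variable {n : ℕ}

/-- **For EVERY probability weight and ARBITRARY events `W ⊆ U_1 ∩ ⋯ ∩ U_n`: `E_{n+1}(1_W, 1_{U_1}, …, 1_{U_n}) ≥ 0`** (the order-`n+1` Sahi functional of
a family one of whose events lies inside all the others; `n + 1 = 2`: `Cov(1_U, 1_W) = μ(W)(1 − μ(U))`; `n + 1 = 3`: tree `sahiE3_nonneg_of_subset`). [this work] -/
theorem sahiE_setInd_cons_nonneg_of_subset [DecidableEq α] {μ : α → ℝ} (hμ0 : ∀ x, 0 ≤ μ x) (hμ1 : ∑ x, μ x = 1) (W : Finset α)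
    (U : Fin n → Finset α) (hW : ∀ j, W ⊆ U j) :
    0 ≤ sahiE μ (n + 1) (Fin.cons (setInd W) (fun j => setInd (U j))) := by
  refine sahiE_cons_nonneg_of_absorbed μ (setInd W) (fun j => setInd (U j)) (fun j x => ?_) ?_ (fun B _ => ?_)
  · unfold setInd
    by_cases hx : x ∈ W
    · simp [hx, hW j hx]
    · simp [hx]
  · exact ex_nonneg hμ0 fun x => setInd_nonneg W x
  · calc ex μ (fun x => ∏ j ∈ B, setInd (U j) x) ≤ ex μ (fun _ => (1 : ℝ)) :=
          ex_mono hμ0 fun x => prod_le_one (fun j _ => setInd_nonneg _ _) fun j _ => by unfold setInd; split_ifs <;> norm_num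
      _ = 1 := ex_const hμ1 1

/-- **The same with the absorbed member in ANY slot** (`E_{n+1}` is symmetric): for a probability weight, events `U_0, …, U_n` and a slot `k` with
`U_k ⊆ U_j` for all `j`, `E_{n+1}(1_{U_0}, …, 1_{U_n}) ≥ 0`. [this work] -/
theorem sahiE_setInd_nonneg_of_subset_all [DecidableEq α] {μ : α → ℝ} (hμ0 : ∀ x, 0 ≤ μ x) (hμ1 : ∑ x, μ x = 1)
    (U : Fin (n + 1) → Finset α) (k : Fin (n + 1)) (hk : ∀ j, U k ⊆ U j) :
    0 ≤ sahiE μ (n + 1) (fun j => setInd (U j)) := by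
  -- move slot `k` to the front: `σ 0 = k`, `σ (succ j) = k.succAbove j`
  have h := sahiE_setInd_cons_nonneg_of_subset hμ0 hμ1 (U k) (fun j => U (k.succAbove j)) fun j => hk _
  set σ : Perm (Fin (n + 1)) := (finSuccEquiv' (0 : Fin (n + 1))).trans (finSuccEquiv' k).symm with hσ
  have hσ0 : σ 0 = k := by simp [hσ]
  have hσs : ∀ j : Fin n, σ j.succ = k.succAbove j := by
    intro j
    simp only [hσ, Equiv.trans_apply]
    rw [← Fin.succAbove_zero, finSuccEquiv'_succAbove, finSuccEquiv'_symm_some]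
  have hfam : (Fin.cons (setInd (U k)) (fun j => setInd (U (k.succAbove j))) : Fin (n + 1) → α → ℝ) =
      fun j => (fun i => setInd (U i)) (σ j) := by
    funext j
    refine Fin.cases ?_ (fun i => ?_) j
    · rw [Fin.cons_zero, hσ0]
    · rw [Fin.cons_succ, hσs]
  rw [hfam] at h
  have hperm := sahiE_comp_perm μ (n + 1) σ (fun i => setInd (U i))
  rw [hperm] at h
  exact h

end Events

end SahiAbsorbed

end Summit.CriticalPhenomena.PercolationContinuityZ3.Theorems
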